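import Literature.Algebra.EuclideanLattices.IntegerBases
import Mathlib.Algebra.Order.BigOperators.Ring.Finset
import Mathlib.Algebra.Order.Floor.Ring
import HarnessLib

/-!
# The combining procedure of Micciancio–Regev 2007 (Lemma 5.8): lattice membership and distance bound

Topic `Algebra/EuclideanLattices` (family `pqc`). Fully PROVED deterministic content of
**Micciancio–Regev 2007, Lemma 5.8** ("Combining Procedure", authors' version pp. 20–21), the heart
of the worst-case/average-case reductions of MR07 Thm. 5.9 (`IncGDD → SIS`) and Thm. 5.23
(`GapCVP′ → SIS′`, tree: `Literature.Computability.Cryptography.MicciancioRegev2007_gapCVP'_to_SIS'`,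
whose procedure `W(B, S)` runs `A_F(B*, S, C, q)`). Written for the decomposition of that fact.

The procedure `A_F(B, S, C, q)`: given a lattice `L = L(B)`, a full-rank sublattice basis
`S = [s₁, …, sₙ] ⊂ L`, vectors `c₁, …, c_m`, and `q ≥ 1`: (1) pick `vᵢ ∈ L`, (2) `wᵢ = (vᵢ + cᵢ) mod P(S)`,
(3) `aᵢ = ⌊q S⁻¹ wᵢ⌋ ∈ ℤⁿ` (query `A = [a₁, …, a_m]`), (4) `z = F(A)`, (5) output
`x = (C - W + S A/q) z = ∑ᵢ zᵢ (cᵢ - wᵢ) + S (A z)/q`.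

## Results (for a real basis `S` of an `ℝ`-vector space `V` and an additive subgroup `L ∋ sⱼ`)

* `MicciancioRegev2007.combine_mem` — **second property**: if every `cᵢ - wᵢ ∈ L` (which is what
  steps (1)–(2) give: `wᵢ ≡ vᵢ + cᵢ (mod L(S))`, `L(S) ⊆ L`, `vᵢ ∈ L`) and `A z ≡ 0 (mod q)`
  coordinatewise (`z ∈ Λ_q(A)`), then `x ∈ L` ("an integer linear combination of lattice vectors").
* `MicciancioRegev2007.combine_sub_eq` — the identity `x - C z = -(1/q) ∑ⱼ (∑ᵢ zᵢ {uᵢⱼ}) sⱼ` with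
  `uᵢ = q S⁻¹ wᵢ` and `{·}` the fractional part (p. 21, last display).
* `MicciancioRegev2007.norm_combine_sub_le` — **third property**, `ℓ₁` form:
  `‖x - C z‖ ≤ n (∑ᵢ |zᵢ|) ‖S‖ / q` where `‖S‖ = maxⱼ ‖sⱼ‖` (any bound `σ ≥ ‖sⱼ‖`), and
  `MicciancioRegev2007.norm_combine_sub_le_sqrt` — the printed form
  `‖x - C z‖ ≤ n √m ‖z‖ ‖S‖ / q` (`∑ᵢ |zᵢ| ≤ √m ‖z‖`, `sum_abs_le_sqrt_card_mul_norm`, with `‖z‖` the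
  Euclidean norm of `z ∈ ℤᵐ`, `Literature.Algebra.EuclideanLattices.intVecToEuclidean`).

The first property of Lemma 5.8 (uniformity of the query `A` for uniform `C ∈ P(B)ᵐ`) is a
statement about distributions and is not treated here; nor is `wᵢ ∈ P(S)` needed for the two
properties above (the floor is taken of arbitrary real coordinates). Everything is stated for the
explicit expressions (no new definitions), over any real normed space `V` with a `Basis (Fin n) ℝ V`.

## References

* D. Micciancio, O. Regev, *Worst-case to average-case reductions based on Gaussian measures*,
  SIAM J. Comput. 37 (2007) 267–302; authors' version, Lemma 5.8 and its proof (pp. 20–21), used in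
  Thm. 5.9 (p. 23) and Thm. 5.23 (pp. 29–31) (`lit read doi:10.1137/S0097539705447360`).
-/

noncomputable section

open Finset Module

namespace Literature.Algebra.EuclideanLattices

variable {V : Type*} [NormedAddCommGroup V] [NormedSpace ℝ V] {n m : ℕ} (S : Basis (Fin n) ℝ V)

/-- **MR07 Lemma 5.8, second property** (p. 21: "`cᵢ - wᵢ = ((cᵢ + vᵢ) - wᵢ) - vᵢ` belongs to the
lattice … Also, `A z/q` is an integer vector because `A z = 0 mod q`. This proves that `x` belongs to
the lattice"): with `aᵢⱼ = ⌊q (S⁻¹ wᵢ)ⱼ⌋`, if all `cᵢ - wᵢ ∈ L`, all `sⱼ ∈ L` and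
`q ∣ ∑ᵢ zᵢ aᵢⱼ` for every `j`, then `x = ∑ᵢ zᵢ (cᵢ - wᵢ) + q⁻¹ ∑ⱼ (∑ᵢ zᵢ aᵢⱼ) sⱼ ∈ L`.
[cite: MicciancioRegev2007, Lemma 5.8 (second property, proof p. 21)] -/
theorem MicciancioRegev2007.combine_mem {L : AddSubgroup V} (hS : ∀ j, S j ∈ L) {q : ℕ} (hq : 0 < q)
    {c w : Fin m → V} (hcw : ∀ i, c i - w i ∈ L) {z : Fin m → ℤ}
    (hz : ∀ j, (q : ℤ) ∣ ∑ i, z i * ⌊(q : ℝ) * S.repr (w i) j⌋) :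
    (∑ i, (z i : ℝ) • (c i - w i) +
        (q : ℝ)⁻¹ • ∑ j, ((∑ i, z i * ⌊(q : ℝ) * S.repr (w i) j⌋ : ℤ) : ℝ) • S j) ∈ L := by
  refine L.add_mem (L.sum_mem fun i _ => ?_) ?_
  · rw [Int.cast_smul_eq_zsmul]
    exact L.zsmul_mem (hcw i) _
  · rw [Finset.smul_sum]
    refine L.sum_mem fun j _ => ?_
    obtain ⟨k, hk⟩ := hz j
    rw [hk, smul_smul]
    push_cast
    rw [← mul_assoc, inv_mul_cancel₀ (by exact_mod_cast hq.ne'), one_mul, Int.cast_smul_eq_zsmul]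
    exact L.zsmul_mem (hS j) _

/-- **The error identity of MR07 Lemma 5.8** (proof of the third property, p. 21):
`x - C z = ∑ᵢ (wᵢ - (S/q) aᵢ) (-zᵢ)`, i.e. with `uᵢ = q S⁻¹ wᵢ`,
`x - C z = -(q⁻¹) ∑ⱼ (∑ᵢ zᵢ (uᵢⱼ - ⌊uᵢⱼ⌋)) sⱼ`. [cite: MicciancioRegev2007, Lemma 5.8 (proof p. 21)] -/
theorem MicciancioRegev2007.combine_sub_eq {q : ℕ} (hq : 0 < q) (c w : Fin m → V) (z : Fin m → ℤ) :
    (∑ i, (z i : ℝ) • (c i - w i) +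
        (q : ℝ)⁻¹ • ∑ j, ((∑ i, z i * ⌊(q : ℝ) * S.repr (w i) j⌋ : ℤ) : ℝ) • S j) -
      ∑ i, (z i : ℝ) • c i =
    -((q : ℝ)⁻¹ • ∑ j, (∑ i, (z i : ℝ) * Int.fract ((q : ℝ) * S.repr (w i) j)) • S j) := by
  have hq' : (q : ℝ) ≠ 0 := by exact_mod_cast hq.ne'
  -- expand `wᵢ` in the basis `S`: `wᵢ = q⁻¹ ∑ⱼ uᵢⱼ sⱼ`
  have hw : ∀ i, w i = (q : ℝ)⁻¹ • ∑ j, ((q : ℝ) * S.repr (w i) j) • S j := fun i => by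
    rw [Finset.smul_sum]
    conv_lhs => rw [← S.sum_repr (w i)]
    refine Finset.sum_congr rfl fun j _ => ?_
    rw [smul_smul, ← mul_assoc, inv_mul_cancel₀ hq', one_mul]
  -- everything is a combination of the `sⱼ`; compare coefficients
  have hlhs : (∑ i, (z i : ℝ) • (c i - w i) +
        (q : ℝ)⁻¹ • ∑ j, ((∑ i, z i * ⌊(q : ℝ) * S.repr (w i) j⌋ : ℤ) : ℝ) • S j) -
      ∑ i, (z i : ℝ) • c i =
      -(∑ i, (z i : ℝ) • w i) +
        (q : ℝ)⁻¹ • ∑ j, ((∑ i, z i * ⌊(q : ℝ) * S.repr (w i) j⌋ : ℤ) : ℝ) • S j := by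
    simp only [smul_sub, Finset.sum_sub_distrib]
    abel
  rw [hlhs]
  have hzw : ∑ i, (z i : ℝ) • w i = (q : ℝ)⁻¹ • ∑ j, (∑ i, (z i : ℝ) * ((q : ℝ) * S.repr (w i) j)) • S j := by
    simp_rw [Finset.sum_smul, Finset.smul_sum]
    rw [Finset.sum_comm]
    refine Finset.sum_congr rfl fun i _ => ?_
    conv_lhs => rw [hw i]
    rw [Finset.smul_sum, Finset.smul_sum]
    refine Finset.sum_congr rfl fun j _ => ?_
    simp only [smul_smul]
    ring_nf
  rw [hzw, ← smul_neg, ← smul_add, ← smul_neg]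
  congr 1
  rw [← Finset.sum_neg_distrib, ← Finset.sum_neg_distrib, ← Finset.sum_add_distrib]
  refine Finset.sum_congr rfl fun j _ => ?_
  rw [← neg_smul, ← neg_smul, ← add_smul]
  congr 1
  push_cast
  rw [← Finset.sum_neg_distrib, ← Finset.sum_neg_distrib, ← Finset.sum_add_distrib]
  refine Finset.sum_congr rfl fun i _ => ?_
  rw [Int.fract]
  ring

/-- `ℓ₁ ≤ √m · ℓ₂` for integer vectors (Cauchy–Schwarz; MR07 p. 21: "`∑ᵢ |zᵢ| ≤ √m ‖z‖`"), with
`‖z‖` the Euclidean norm of `z ∈ ℤᵐ` read in `ℝᵐ` (`intVecToEuclidean`). [folklore] -/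
theorem sum_abs_le_sqrt_card_mul_norm (z : Fin m → ℤ) :
    ∑ i, |(z i : ℝ)| ≤ Real.sqrt m * ‖intVecToEuclidean m z‖ := by
  rw [norm_intVecToEuclidean, ← Real.sqrt_mul (Nat.cast_nonneg m)]
  refine Real.le_sqrt_of_sq_le ?_
  calc (∑ i, |(z i : ℝ)|) ^ 2 = (∑ i, 1 * |(z i : ℝ)|) ^ 2 := by simp
    _ ≤ (∑ _i : Fin m, (1 : ℝ) ^ 2) * ∑ i, |(z i : ℝ)| ^ 2 := sum_mul_sq_le_sq_mul_sq _ _ _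
    _ = m * ∑ i, (z i : ℝ) ^ 2 := by simp

/-- **MR07 Lemma 5.8, third property, `ℓ₁` form** (proof p. 21: all entries of `uᵢ - ⌊uᵢ⌋` lie in
`[0, 1)`, so the coefficient vector `∑ᵢ (uᵢ - ⌊uᵢ⌋) zᵢ` has entries bounded by `∑ᵢ |zᵢ|`, and the
triangle inequality over the `n` columns of `S` gives the bound): if `‖sⱼ‖ ≤ σ` for all `j` then
`‖x - C z‖ ≤ n (∑ᵢ |zᵢ|) σ / q`. [cite: MicciancioRegev2007, Lemma 5.8 (third property, proof p. 21)] -/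
theorem MicciancioRegev2007.norm_combine_sub_le {q : ℕ} (hq : 0 < q) (c w : Fin m → V)
    (z : Fin m → ℤ) {σ : ℝ} (hSσ : ∀ j, ‖S j‖ ≤ σ) :
    ‖(∑ i, (z i : ℝ) • (c i - w i) +
        (q : ℝ)⁻¹ • ∑ j, ((∑ i, z i * ⌊(q : ℝ) * S.repr (w i) j⌋ : ℤ) : ℝ) • S j) -
      ∑ i, (z i : ℝ) • c i‖ ≤ n * (∑ i, |(z i : ℝ)|) * σ / q := by
  have hq' : (0 : ℝ) < q := by exact_mod_cast hq
  rw [MicciancioRegev2007.combine_sub_eq S hq, norm_neg, norm_smul, norm_inv, Real.norm_natCast]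
  have hcoef : ∀ j, |∑ i, (z i : ℝ) * Int.fract ((q : ℝ) * S.repr (w i) j)| ≤ ∑ i, |(z i : ℝ)| :=
    fun j => (Finset.abs_sum_le_sum_abs _ _).trans (Finset.sum_le_sum fun i _ => by
      rw [abs_mul]
      calc |(z i : ℝ)| * |Int.fract ((q : ℝ) * S.repr (w i) j)| ≤ |(z i : ℝ)| * 1 := by
            gcongr
            rw [abs_of_nonneg (Int.fract_nonneg _)]
            exact (Int.fract_lt_one _).le
        _ = |(z i : ℝ)| := mul_one _)
  calc (q : ℝ)⁻¹ * ‖∑ j, (∑ i, (z i : ℝ) * Int.fract ((q : ℝ) * S.repr (w i) j)) • S j‖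
      ≤ (q : ℝ)⁻¹ * ∑ j, ‖(∑ i, (z i : ℝ) * Int.fract ((q : ℝ) * S.repr (w i) j)) • S j‖ := by
        gcongr
        exact norm_sum_le _ _
    _ ≤ (q : ℝ)⁻¹ * ∑ _j : Fin n, (∑ i, |(z i : ℝ)|) * σ := by
        gcongr with j
        rw [norm_smul, Real.norm_eq_abs]
        exact mul_le_mul (hcoef j) (hSσ j) (norm_nonneg _) (Finset.sum_nonneg fun i _ => abs_nonneg _)
    _ = n * (∑ i, |(z i : ℝ)|) * σ / q := by
        rw [Finset.sum_const, Finset.card_univ, Fintype.card_fin, nsmul_eq_mul]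
        field_simp

/-- **MR07 Lemma 5.8, third property as printed**: `‖x - C z‖ ≤ n √m ‖z‖ ‖S‖ / q`, with `‖z‖` the
Euclidean norm of `z ∈ ℤᵐ` and `‖S‖ = maxⱼ ‖sⱼ‖` (any `σ` with `‖sⱼ‖ ≤ σ`). In Thm. 5.9 (p. 23) this is
`≤ ‖S‖/g` for `q ≥ g n √m β`; in Thm. 5.23 (p. 31) it is `≤ 2β η_ε(B*) < sβ`.
[cite: MicciancioRegev2007, Lemma 5.8 (third property, p. 21)] -/
theorem MicciancioRegev2007.norm_combine_sub_le_sqrt {q : ℕ} (hq : 0 < q) (c w : Fin m → V)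
    (z : Fin m → ℤ) {σ : ℝ} (hSσ : ∀ j, ‖S j‖ ≤ σ) :
    ‖(∑ i, (z i : ℝ) • (c i - w i) +
        (q : ℝ)⁻¹ • ∑ j, ((∑ i, z i * ⌊(q : ℝ) * S.repr (w i) j⌋ : ℤ) : ℝ) • S j) -
      ∑ i, (z i : ℝ) • c i‖ ≤ n * Real.sqrt m * ‖intVecToEuclidean m z‖ * σ / q := by
  refine (MicciancioRegev2007.norm_combine_sub_le S hq c w z hSσ).trans ?_
  rcases Nat.eq_zero_or_pos n with hn | hn
  · subst hn
    simp
  · have hσ : 0 ≤ σ := (norm_nonneg _).trans (hSσ ⟨0, hn⟩)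
    have hq' : (0 : ℝ) < q := by exact_mod_cast hq
    rw [mul_assoc (n : ℝ) (Real.sqrt m)]
    gcongr
    exact sum_abs_le_sqrt_card_mul_norm z

end Literature.Algebra.EuclideanLattices

end
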